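import Literature.AlgebraicGeometry.RelativeSpec.SymmetricPowerGlued
import Literature.AlgebraicGeometry.Motives.CartierDivisor
import Mathlib.AlgebraicGeometry.Morphisms.Flat
import HarnessLib

/-!
# WildQuotients / `GaloisQuotientAlteration` (stmt-ResolutionOfSingularities-16323): lemmas for
# the descent of a Galois alteration datum from the perfect closure

Route `ResolutionOfSingularities/WildQuotients`, support item `GaloisQuotientAlteration`. The
bridge "de Jong's Galois alteration for normal projective varieties over PERFECT fields ⇒ the
item over EVERY field of characteristic `p`" descends the datum `(G, Y, ρ, π)` produced over the
perfect closure `K = k^{p^{-∞}}` to a finite stage `k(t) ⊆ K`, through a `G`-equivariant closed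
embedding of `Y` into the `K`-base-change of the `k`-scheme `Q = (ℙᵐ_k)ⁿ ×_k X`, `n = |G|`, on
which `G` acts `k`-rationally by permuting the factors (Cayley). This file collects the
hypothesis-free lemmas used there:

* `finsetAffine_of_isAffineHom`, `finsetAffine_pullback`, `finsetAffine_powOver` — the clause
  "every finite set of points lies in an affine open" (Mumford, AV §7, Rem. p. 69) passes along
  affine morphisms, to fibre products over an affine base, and to the fibre powers `Xⁿ_Y` over an
  affine `Y` (the box `Wⁿ_Y` on an affine open `W` containing all coordinates);
* `flat_of_field` — every morphism to the spectrum of a field is flat;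
* `functionFieldMap_apply_eq_of_equivariant` — along a `G`-equivariant dominant morphism
  `e : Y → Y_t`, rational functions on `Y_t` invariant under `G` pull back to invariant rational
  functions on `Y`.

Everything is proved; no named fact is used.
-/

noncomputable section

set_option linter.dupNamespace false -- mandated namespace of this single-conjunct summit

namespace Summit.ResolutionOfSingularities.ResolutionOfSingularities.Theorems

open CategoryTheory CategoryTheory.Limits AlgebraicGeometry TopologicalSpace
open Literature.AlgebraicGeometry.RelativeSpec
open Literature.AlgebraicGeometry.Motives (RatFn.functionFieldMap RatFn.functionFieldMap_comp)

universe u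

/-! ## Finite subsets in affine opens -/

/-- **Finite subsets in affine opens pull back along affine morphisms**: if every finite subset
of `Y` lies in an affine open and `f : X → Y` is affine, the same holds for `X` (take the
preimage). [cite: MumfordAV1970, §7 Remark p. 69] -/
theorem finsetAffine_of_isAffineHom {X Y : Scheme.{u}} (f : X ⟶ Y) [IsAffineHom f]
    (hY : ∀ S : Finset Y, ∃ U : Y.Opens, IsAffineOpen U ∧ (↑S : Set Y) ⊆ U) :
    ∀ S : Finset X, ∃ U : X.Opens, IsAffineOpen U ∧ (↑S : Set X) ⊆ U := by
  classical
  intro S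
  obtain ⟨U, hU, hS⟩ := hY (S.image f.base)
  refine ⟨f ⁻¹ᵁ U, hU.preimage f, fun x hx => hS ?_⟩
  exact Finset.mem_coe.mpr (Finset.mem_image_of_mem _ (Finset.mem_coe.mp hx))

/-- **Finite subsets in affine opens in a fibre product over an affine base**: if every finite
subset of `X` and of `Y` lies in an affine open and `S` is affine, every finite subset of
`X ×_S Y` lies in an affine open — the box `U ×_S V` on affine opens `U ⊇ pr₁(T)`, `V ⊇ pr₂(T)`.
[cite: MumfordAV1970, §7 Remark p. 69] -/
theorem finsetAffine_pullback {X Y S : Scheme.{u}} (f : X ⟶ S) (g : Y ⟶ S) [IsAffine S]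
    (hX : ∀ T : Finset X, ∃ U : X.Opens, IsAffineOpen U ∧ (↑T : Set X) ⊆ U)
    (hY : ∀ T : Finset Y, ∃ U : Y.Opens, IsAffineOpen U ∧ (↑T : Set Y) ⊆ U) :
    ∀ T : Finset ↑(pullback f g), ∃ U : (pullback f g).Opens, IsAffineOpen U ∧
      (↑T : Set ↑(pullback f g)) ⊆ U := by
  classical
  intro T
  obtain ⟨U, hU, hTU⟩ := hX (T.image (pullback.fst f g).base)
  obtain ⟨V, hV, hTV⟩ := hY (T.image (pullback.snd f g).base)
  haveI : IsAffine U := hU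
  haveI : IsAffine V := hV
  -- the box `U ×_S V ↪ X ×_S Y`
  let ι := pullback.map (U.ι ≫ f) (V.ι ≫ g) f g U.ι V.ι (𝟙 S)
    ((Category.comp_id _).trans rfl) ((Category.comp_id _).trans rfl)
  haveI : IsOpenImmersion ι :=
    MorphismProperty.pullbackMap (P := @IsOpenImmersion) inferInstance inferInstance rfl rfl
  refine ⟨ι.opensRange, isAffineOpen_opensRange ι, fun z hz => ?_⟩
  change z ∈ Set.range ι.base
  rw [Scheme.Pullback.range_map]
  refine ⟨?_, ?_⟩
  · change (pullback.fst f g).base z ∈ Set.range U.ι.base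
    rw [Scheme.Opens.range_ι]
    exact hTU (Finset.mem_coe.mpr (Finset.mem_image_of_mem _ (Finset.mem_coe.mp hz)))
  · change (pullback.snd f g).base z ∈ Set.range V.ι.base
    rw [Scheme.Opens.range_ι]
    exact hTV (Finset.mem_coe.mpr (Finset.mem_image_of_mem _ (Finset.mem_coe.mp hz)))

/-- **Finite subsets in affine opens in a fibre power `Xⁿ_Y` over an affine `Y`**: the box
`Wⁿ_Y` on an affine open `W ⊆ X` containing all the coordinates of the given points is affine
(`powOpenIso : Wⁿ_Y ≅ (W)ⁿ_Y`, and `Wⁿ_Y → Y` is affine). [cite: MumfordAV1970, §7 Remark p. 69] -/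
theorem finsetAffine_powOver {X Y : Scheme.{u}} (r : X ⟶ Y) [IsAffine Y] (n : ℕ)
    (hX : ∀ T : Finset X, ∃ U : X.Opens, IsAffineOpen U ∧ (↑T : Set X) ⊆ U) :
    ∀ T : Finset ↑(powOver r n), ∃ U : (powOver r n).Opens, IsAffineOpen U ∧
      (↑T : Set ↑(powOver r n)) ⊆ U := by
  classical
  intro T
  obtain ⟨W, hW, hTW⟩ := hX (Finset.univ.biUnion fun i : Fin n => T.image (powOver.proj r n i).base)
  haveI : IsAffine W := hW
  -- `Wⁿ_Y` is affine
  haveI : IsAffineHom (powOver.base (W.ι ≫ r) n) := isAffineHom_powOver_base (W.ι ≫ r) n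
  haveI : IsAffine (powOver (W.ι ≫ r) n) := isAffine_of_isAffineHom (powOver.base (W.ι ≫ r) n)
  have hA : IsAffineOpen (powOpen r n W) := IsAffine.of_isIso (powOpenIso r n W).hom
  refine ⟨powOpen r n W, hA, fun z hz => ?_⟩
  rw [SetLike.mem_coe, mem_powOpen]
  intro i
  apply hTW
  rw [Finset.coe_biUnion]
  exact Set.mem_iUnion₂.mpr ⟨i, Finset.mem_coe.mpr (Finset.mem_univ i),
    Finset.mem_coe.mpr (Finset.mem_image_of_mem _ (Finset.mem_coe.mp hz))⟩

/-! ## Flatness over a field -/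

/-- **Every morphism to the spectrum of a field is flat**: the stalks of `Spec K` are the field
`K(Spec K)`, and every module over a field is flat. [folklore] -/
theorem flat_of_field {Y : Scheme.{u}} {K : Type u} [Field K] (g : Y ⟶ Spec (.of K)) : Flat g := by
  refine Flat.of_stalkMap _ fun y => ?_
  have hfield : IsField ((Spec (CommRingCat.of K)).presheaf.stalk (g y)) := by
    rw [Subsingleton.elim (g y) (genericPoint (Spec (CommRingCat.of K)))]
    exact Field.toIsField (Spec (CommRingCat.of K)).functionField
  exact RingHom.Flat.of_isField hfield _

/-! ## Invariant rational functions along an equivariant dominant morphism -/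

/-- **Invariants pull back to invariants.** Let `e : Y → Y_t` be a dominant morphism of integral
schemes, equivariant for actions `ρ : G → Aut Y`, `τ : G → Aut Y_t` (`ρ(h) ≫ e = e ≫ τ(h)`). If
`a ∈ K(Y_t)` is fixed by all `τ(h)♯` then `e♯ a ∈ K(Y)` is fixed by all `ρ(h)♯` (functoriality
of `K(-)` along dominant morphisms). [folklore] -/
theorem functionFieldMap_apply_eq_of_equivariant {Y Yt : Scheme.{u}} [IsIntegral Y]
    [IsIntegral Yt] (e : Y ⟶ Yt) [IsDominant e] {G : Type*} [Group G] (ρ : G →* Aut Y)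
    (τ : G →* Aut Yt) (heq : ∀ h : G, (ρ h).hom ≫ e = e ≫ (τ h).hom) (a : Yt.functionField)
    (ha : ∀ h : G, RatFn.functionFieldMap (τ h).hom a = a) (h : G) :
    RatFn.functionFieldMap (ρ h).hom (RatFn.functionFieldMap e a) = RatFn.functionFieldMap e a := by
  have h1 : RatFn.functionFieldMap ((ρ h).hom ≫ e) a =
      RatFn.functionFieldMap (ρ h).hom (RatFn.functionFieldMap e a) := by
    rw [RatFn.functionFieldMap_comp e (ρ h).hom]; rfl
  have h2 : RatFn.functionFieldMap (e ≫ (τ h).hom) a =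
      RatFn.functionFieldMap e (RatFn.functionFieldMap (τ h).hom a) := by
    rw [RatFn.functionFieldMap_comp (τ h).hom e]; rfl
  have h3 : RatFn.functionFieldMap ((ρ h).hom ≫ e) a = RatFn.functionFieldMap (e ≫ (τ h).hom) a := by
    simp only [heq h]
  rw [← h1, h3, h2, ha h]

end Summit.ResolutionOfSingularities.ResolutionOfSingularities.Theorems

end
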